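import Literature.NumberTheory.EllipticCurves.WeilPairingProofs
import Literature.NumberTheory.EllipticCurves.IsogenyFactorProofs
import Literature.NumberTheory.EllipticCurves.IsogenySeparableFactorProofs
import Literature.NumberTheory.EllipticCurves.IsogenyQuotientPlacesProofs
import Literature.NumberTheory.EllipticCurves.MazurTorsionGaloisStructureProofs
import HarnessLib

/-!
# Descent through an isogeny with rational cyclic kernel: the Kummer map read off a Weil function
# (Silverman, *AEC*, Exercise 10.1(c), in the language of III.§8)

Topic `NumberTheory/EllipticCurves`. Let `E/K` be an elliptic curve over a perfect field `K`,
`N` a prime invertible in `K`, and `T ∈ E(K)` a rational point of order `N`; write `⟨T⟩ ≅ ℤ/N`,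
`φ : E → E' = E/⟨T⟩` and `φ̂ : E' → E` for the dual isogeny (kernel `φ(E[N]) ≅ μ_N`). The
connecting homomorphism of the `φ̂`-descent, `E(K)/φ̂(E'(K)) ↪ H¹(K, ker φ̂) ≅ Kˣ/Kˣᴺ`, is the
"Kummer map" `P ↦ f_T(P) mod Kˣᴺ` for a function `f_T ∈ K(E)` with `div f_T = N(T) - N(O)`
(Silverman, *AEC*, Exercise 10.1(c), PDF p. 304; degree `2`: Prop. X.4.9, Thm. X.1.1). This file
proves the **injectivity half of that statement entirely on `E`**, with no reference to `E'`,
`φ`, `φ̂` or group cohomology, in the form consumed by the explicit `5`-descent on `X₁(11)`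
(`X1ElevenKummerValues`, `X1ElevenFiveIsogeny`): a point `P' ∈ E'(K)` with `φ̂ P' = P` is the
same as a point `R ∈ E(K̄)` with `N R = P` whose coset `R + ⟨T⟩` is `Γ_K`-stable (then
`P' = φ R`), and

* **`exists_stableCoset_of_kummer_eq_pow`**: if `f ∈ K̄(E)` has
  `ord_Q f = N·([Q = T] - [Q = O])`, if some `R₂` with `Γ_K`-stable coset `R₂ + ⟨T⟩` has
  `N R₂ = P₂ ∉ {O, T}` (a normalisation point: in the application `R₂` lies over a known rational
  point), and if `P ∈ E(K̄)^{Γ_K} ∖ {O, T}` satisfies `f(P) = uᴺ · f(P₂)` with `u ∈ K`, then there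
  is `R` with `N R = P` and `σ R - R ∈ ⟨T⟩` for all `σ ∈ Γ_K`.

## The proof (Silverman III.§8 run backwards)

Let `h = h_T` be a Weil function for `T` (tree `IsWeilFunction`: `ord_Q h = 𝟙_{E[N]}(Q - T') -
𝟙_{E[N]}(Q)`, `N T' = T`; Silverman's `g` with `gᴺ = f_T ∘ [N]`, III.§8 p. 93) and
`e(S, T) = τ_S^* h / h ∈ μ_N` the Weil pairing (tree `weilPairingFun`, Prop. III.8.1 proved).
* `[N]^* f` and `hᴺ` have the same divisor (`ord_pullbackHom_zsmul`: `[N]` is unramified), so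
  `[N]^* f = c · hᴺ` (`exists_eq_smul_of_ord_eq`), and **`f(N R) = c · h(R)ᴺ`** wherever `h` is a
  unit (`hasValueAt_pullbackHom_zsmul`, values of pull-backs along `[N]` at every point).
* **Translation**: `h(R + S) = e(S, T) · h(R)` for `S ∈ E[N]` (`τ_S^* h = e(S,T) h` and
  `(τ_S^* h)(R) = h(R + S)`, tree `HasValueAt.transAlgHom`).
* **Galois**: `σ̃ h` is a Weil function for `σ T = T`, hence `σ̃ h = λ_σ h`, and
  `(σ̃ h)(σ R) = σ(h(R))`; so **`σ(h(R)) = λ_σ · e(σR - R, T) · h(R)`** when `N(σR - R) = O`.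
* For the quotient `w = h(R)/h(R₂)` the unknown `λ_σ` **cancels**: `σ w = e(σR - R, T) · w`
  (as `σR₂ - R₂ ∈ ⟨T⟩` pairs trivially with `T`, `e(T, T) = 1`), while
  `wᴺ = f(P)/f(P₂) = uᴺ`, `w = ζ u` with `ζᴺ = 1`.
* `e(·, T) : E[N] → μ_N` is onto with kernel exactly `⟨T⟩` (`N` prime, `T ≠ O`: a frame
  `E[N] ≃ 𝔽_N²` through `T`, tree `exists_addEquiv_apply_eq_single`, non-degeneracy
  `eq_zero_of_weilPairingFun_eq_one` and `e(T,T) = 1`): replacing `R` by `R + S₀` with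
  `e(S₀, T) = ζ⁻¹` makes `w = u ∈ K`, so `e(σR - R, T) = 1` and `σR - R ∈ ⟨T⟩` for all `σ`.

## Main statements (all proved)

* `hasValueAt_pullbackHom_zsmul` (`([N]^* z)(R) = z(N R)` for `N R ≠ O`),
  `exists_hasValueAt_ne_zero_of_ord_eq_zero` (a unit at `R` has a non-zero value there).
* `IsWeilFunction.hasValueAt_add` (`h(R + S) = e(S,T) h(R)`),
  `IsWeilFunction.smul_value` (`σ(h(R)) = λ_σ e(σR - R, T) h(R)`).
* `weilPairingFun_eq_one_of_mem_zmultiples`, `mem_zmultiples_of_weilPairingFun_eq_one`,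
  `exists_weilPairingFun_eq` (kernel and image of `e(·, T)` for `N` prime).
* **`exists_stableCoset_of_kummer_eq_pow`** (the descent lemma).

## References

* [SilvermanAEC2009] J. H. Silverman, *The Arithmetic of Elliptic Curves*, 2nd ed., GTM 106
  (2009): III.§8 pp. 92–95 and Prop. III.8.1; Exercise 10.1 (PDF p. 304); Prop. X.4.9,
  Thm. X.1.1; VIII.§2 (the Kummer pairing).
* [Mazur1977] B. Mazur, *Modular curves and the Eisenstein ideal*, Publ. Math. IHÉS 47 (1977),
  Ch. III §3 (the descent through `C ≅ ℤ/n` and the Shimura subgroup `Σ ≅ μ_n`).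

## Design

Theorems only; `noncomputable section`, `open scoped Classical`, universe `u`, dot-notation
extensions in `namespace WeierstrassCurve` next to `IsWeilFunction`, `weilPairingFun`. The level is
a prime `N` with `[Fact N.Prime] [NeZero (N : F)]`; the hypothesis `hN : (N : F) ≠ 0` of the
Weil-pairing files is derived from `NeZero`.
-/

noncomputable section

open scoped Classical
open scoped Polynomial.Bivariate WithZero
open Polynomial IsDedekindDomain

universe u

namespace WeierstrassCurve

open geomPoints Literature.NumberTheory.EllipticCurves.WeierstrassFunctionField
  Literature.NumberTheory.EllipticCurves

variable {F : Type u} [Field F] {W : WeierstrassCurve F} [W.IsElliptic]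

/-! ### Values: pull-backs along `[m]`, units -/

section Values

/-- **`([m]^* z)(R) = z(m R)`** for every `R` with `m R ≠ O`: the pull-back along `[m]` of a
function with value `c` at `m R` has value `c` at `R` (values of `[m]^* x`, `[m]^* y` at every
such point, tree `hasValueAt_pullbackX/Y_zsmul`, and `[m]^* (g/h) = g([m]^*x, [m]^*y)/h(…)`).
Silverman, *AEC*, II.§2 (`φ^* f = f ∘ φ`). [cite: SilvermanAEC2009, II.§2 (p. 20)] -/
theorem hasValueAt_pullbackHom_zsmul {m : ℤ} (hm : m ≠ 0) {R : W.geomPoints} (hR : m • R ≠ 0)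
    {z : W.geomFunctionField} {c : AlgebraicClosure F} (hz : W.HasValueAt z (m • R) c) :
    W.HasValueAt ((Isogeny.zsmul W m hm).pullbackHom z) R c := by
  set φ := Isogeny.zsmul W m hm with hφ
  have hR0 : R ≠ 0 := by rintro rfl; exact hR (smul_zero m)
  have hval : ∀ q : MvPolynomial (Fin 2) (AlgebraicClosure F),
      W.HasValueAt (φ.pullbackHom (W.evalGeneric q)) R (MvPolynomial.eval (xy (m • R)) q) := by
    intro q
    rw [Isogeny.pullbackHom_evalGeneric]
    refine HasValueAt.aeval (fun i => ?_) q
    fin_cases i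
    · simpa using hasValueAt_pullbackX_zsmul (W := W) hm hR
    · simpa using hasValueAt_pullbackY_zsmul (W := W) hm hR
  obtain ⟨g, h, hh, hzg, hg⟩ := hz
  have hne : φ.pullbackHom (W.evalGeneric h) ≠ 0 := (hval h).ne_zero hR0 hh
  have hz' : φ.pullbackHom z = φ.pullbackHom (W.evalGeneric g) / φ.pullbackHom (W.evalGeneric h) := by
    rw [eq_div_iff hne, ← map_mul, hzg]
  rw [hz']
  refine ((hval g).div hR0 (hval h) hh).congr rfl ?_
  rw [hg, mul_div_cancel_right₀ _ hh]

/-- **A unit at `R` has a non-zero value at `R`**: if `ord_R z = 0` (`z ≠ 0`, `R ≠ O`) then `z`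
has a value `c ≠ 0` at `R`. [folklore] -/
theorem exists_hasValueAt_ne_zero_of_ord_eq_zero {z : W.geomFunctionField} (hz : z ≠ 0)
    {R : W.geomPoints} (hR : R ≠ 0)
    (hord : ord (W.baseChange (AlgebraicClosure F)).toAffine R z = 0) :
    ∃ c : AlgebraicClosure F, c ≠ 0 ∧ W.HasValueAt z R c := by
  have hmem : z ∈ (W.place R).toValuationSubring := by
    rw [mem_place_iff]
    exact (placeValuation_le_one_iff_ord_nonneg R hz).mpr hord.ge
  obtain ⟨c, hc⟩ := exists_hasValueAt_of_mem_place hR hmem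
  refine ⟨c, fun h0 => ?_, hc⟩
  subst h0
  have := hc.ord_pos hR hz
  omega

omit [W.IsElliptic] in
/-- The value of a non-zero constant multiple: `(c · z)(R) = c · z(R)`. [folklore] -/
theorem HasValueAt.const_mul {z : W.geomFunctionField} {R : W.geomPoints} {v : AlgebraicClosure F}
    (hz : W.HasValueAt z R v) (c : AlgebraicClosure F) :
    W.HasValueAt (algebraMap (AlgebraicClosure F) W.geomFunctionField c * z) R (c * v) :=
  (hasValueAt_algebraMap c R).mul hz

end Values

/-! ### Weil functions: values under translation and Galois -/

section WeilValues

variable {N : ℕ} (hN : (N : F) ≠ 0)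
include hN

/-- **`h(R + S) = e(S, T) · h(R)`** for a Weil function `h` of `T`, `S ∈ E[N]` and `R ∉ E[N]`
at which `h` has value `w` (`τ_S^* h = e(S,T) h` and `(τ_S^* h)(R) = h(R + S)`).
Silverman, *AEC*, III.§8 p. 94 (`e(S,T) = g(X + S)/g(X)`). [cite: SilvermanAEC2009, III.§8 (definition of e_m)] -/
theorem IsWeilFunction.hasValueAt_add {T : W.geomPoints} {h : W.geomFunctionField}
    (hh : IsWeilFunction W N T h) (hT : (N : ℤ) • T = 0) {S : W.geomPoints} (hS : (N : ℤ) • S = 0)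
    {R : W.geomPoints} (hR : (N : ℤ) • R ≠ 0) {w w' : AlgebraicClosure F}
    (hw : W.HasValueAt h R w) (hw' : W.HasValueAt h (R + S) w') :
    w' = weilPairingFun hN S T * w := by
  have hR0 : R ≠ 0 := by rintro rfl; exact hR (smul_zero _)
  have hRS : R ≠ S := by rintro rfl; exact hR hS
  have hRS' : R + S ≠ 0 := by
    intro h0
    apply hR
    rw [show R = -S from eq_neg_of_add_eq_zero_left h0, smul_neg, hS, neg_zero]
  have h1 : W.HasValueAt (W.transAlgHom S h) R w' := hw'.transAlgHom hR0 hRS hRS'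
  have h2 : W.HasValueAt (W.transAlgHom S h) R (weilPairingFun hN S T * w) := by
    rw [hh.transAlgHom_eq hN hS hT]
    exact hw.const_mul _
  exact h1.unique hR0 h2

omit hN in
/-- **`σ̃ h = λ_σ h`** for a Weil function `h` of a `Γ_F`-fixed `T` (`σ̃ h` is a Weil function
for `σ T = T`, and Weil functions are unique up to scalars). [folklore] -/
theorem IsWeilFunction.exists_galFunctionField_eq {T : W.geomPoints} {h : W.geomFunctionField}
    (hh : IsWeilFunction W N T h) (σ : Field.absoluteGaloisGroup F) (hσT : σ • T = T) :
    ∃ lam : AlgebraicClosure F, lam ≠ 0 ∧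
      W.galFunctionField σ h = algebraMap (AlgebraicClosure F) W.geomFunctionField lam * h := by
  have h1 := hh.galFunctionField σ
  rw [hσT] at h1
  exact hh.exists_eq_mul h1

omit hN in
/-- The orders of a Weil function `h` of `T` at `Q` vanish off `E[N] ∪ (T' + E[N])`: if
`N Q ∉ {O, T}` then `ord_Q h = 0`. [folklore] -/
theorem IsWeilFunction.ord_eq_zero {T : W.geomPoints} {h : W.geomFunctionField}
    (hh : IsWeilFunction W N T h) {Q : W.geomPoints} (hQ : (N : ℤ) • Q ≠ 0)
    (hQT : (N : ℤ) • Q ≠ T) :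
    ord (W.baseChange (AlgebraicClosure F)).toAffine Q h = 0 := by
  obtain ⟨-, T', hT', hordh⟩ := hh
  rw [hordh, torsionInd_of_ne, torsionInd_of_ne hQ, sub_zero]
  rwa [smul_sub, hT', sub_ne_zero]

omit hN in
/-- A Weil function `h` of `T` has a **non-zero value** at every `Q` with `N Q ∉ {O, T}`.
[folklore] -/
theorem IsWeilFunction.exists_value {T : W.geomPoints} {h : W.geomFunctionField}
    (hh : IsWeilFunction W N T h) {Q : W.geomPoints} (hQ : (N : ℤ) • Q ≠ 0)
    (hQT : (N : ℤ) • Q ≠ T) : ∃ w : AlgebraicClosure F, w ≠ 0 ∧ W.HasValueAt h Q w := by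
  have hQ0 : Q ≠ 0 := by rintro rfl; exact hQ (smul_zero _)
  exact exists_hasValueAt_ne_zero_of_ord_eq_zero hh.1 hQ0 (hh.ord_eq_zero hQ hQT)

/-- **`σ(h(R)) = λ_σ · e(σR - R, T) · h(R)`**: the Galois behaviour of the values of a Weil
function `h` of a `Γ_F`-fixed `T` with `σ̃ h = λ_σ h`, at a point `R` with `N(σR - R) = O` (e.g.
`N R` rational) and `N R ∉ {O, T}`. [cite: SilvermanAEC2009, III.§8 p. 94 and Prop. III.8.1(d) (proof)] -/
theorem IsWeilFunction.smul_value {T : W.geomPoints} {h : W.geomFunctionField}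
    (hh : IsWeilFunction W N T h) (hT : (N : ℤ) • T = 0) (σ : Field.absoluteGaloisGroup F)
    (hσT : σ • T = T) {lam : AlgebraicClosure F}
    (hlam : W.galFunctionField σ h = algebraMap (AlgebraicClosure F) W.geomFunctionField lam * h)
    {R : W.geomPoints} (hR : (N : ℤ) • R ≠ 0) (hRT : (N : ℤ) • R ≠ T)
    (hσR : (N : ℤ) • (σ • R - R) = 0) {w : AlgebraicClosure F} (hw : W.HasValueAt h R w) :
    galRingHom σ w = lam * weilPairingFun hN (σ • R - R) T * w := by
  have hNσR : (N : ℤ) • (σ • R) = σ • ((N : ℤ) • R) := smul_comm _ _ _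
  have hσR0 : (N : ℤ) • (σ • R) ≠ 0 := by
    rw [hNσR, Ne, smul_eq_zero_iff_eq]; exact hR
  have hσRT : (N : ℤ) • (σ • R) ≠ T := by
    rw [hNσR, ← hσT, Ne, smul_left_cancel_iff]; exact hRT
  have hσR' : σ • R ≠ 0 := by intro h0; exact hσR0 (by rw [h0, smul_zero])
  -- `h` has a value `w'` at `σ R = R + (σR - R)`, and `w' = e(σR - R, T) w`
  obtain ⟨w', -, hw'⟩ := hh.exists_value hσR0 hσRT
  have e1 : w' = weilPairingFun hN (σ • R - R) T * w :=
    hh.hasValueAt_add hN hT hσR hR hw (by rwa [add_sub_cancel])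
  -- `σ̃ h = λ h` has value `σ w` at `σ R`, and value `λ w'`
  have h1 : W.HasValueAt (algebraMap (AlgebraicClosure F) W.geomFunctionField lam * h) (σ • R)
      (galRingHom σ w) := hlam ▸ hw.galFunctionField σ
  have h2 := hw'.const_mul lam
  rw [h1.unique hσR' h2, e1, mul_assoc]

end WeilValues

/-! ### The pairing `e(·, T) : E[N] → μ_N` for `N` prime: kernel `⟨T⟩`, image `μ_N` -/

section Pairing

variable {N : ℕ} [NeZero (N : F)]

omit [W.IsElliptic] in
variable (F N) in
/-- `(N : F) ≠ 0` from `NeZero`. [folklore] -/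
theorem natCast_level_ne_zero : (N : F) ≠ 0 := NeZero.ne _

variable [Fact N.Prime]

omit [W.IsElliptic] [NeZero (N : F)] in
/-- An element of `⟨T⟩` is `n • T` with `n : ℕ` when `N T = O`. [folklore] -/
theorem exists_nsmul_eq_of_mem_zmultiples {T S : W.geomPoints} (hT : (N : ℤ) • T = 0)
    (hS : S ∈ AddSubgroup.zmultiples T) : ∃ n : ℕ, n • T = S := by
  obtain ⟨k, rfl⟩ := AddSubgroup.mem_zmultiples_iff.mp hS
  have hN0 : (N : ℤ) ≠ 0 := by exact_mod_cast (Fact.out : N.Prime).ne_zero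
  refine ⟨(k % N).toNat, ?_⟩
  have hnn : 0 ≤ k % N := Int.emod_nonneg _ hN0
  calc ((k % N).toNat) • T = (k % (N : ℤ)) • T := by
          rw [← natCast_zsmul, Int.toNat_of_nonneg hnn]
    _ = (k % (N : ℤ)) • T + (k / (N : ℤ)) • ((N : ℤ) • T) := by rw [hT, smul_zero, add_zero]
    _ = k • T := by rw [smul_smul, ← add_smul, Int.emod_add_ediv_mul]

omit [Fact N.Prime] in
/-- **`e(S, T) = 1` for `S ∈ ⟨T⟩`** (`e(nT, T) = e(T, T)ⁿ = 1`, Silverman, *AEC*,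
Prop. III.8.1(a),(b)). [cite: SilvermanAEC2009, Prop. III.8.1(a),(b)] -/
theorem weilPairingFun_nsmul_self {T : W.geomPoints} (hT : (N : ℤ) • T = 0) (n : ℕ) :
    weilPairingFun (natCast_level_ne_zero F N) (n • T) T = 1 := by
  rw [weilPairingFun_nsmul_left _ hT hT, weilPairingFun_self _ hT, one_pow]

/-- **`e(S, T) = 1` for `S ∈ ⟨T⟩`**. [cite: SilvermanAEC2009, Prop. III.8.1(a),(b)] -/
theorem weilPairingFun_eq_one_of_mem_zmultiples {T S : W.geomPoints} (hT : (N : ℤ) • T = 0)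
    (hS : S ∈ AddSubgroup.zmultiples T) :
    weilPairingFun (natCast_level_ne_zero F N) S T = 1 := by
  obtain ⟨n, rfl⟩ := exists_nsmul_eq_of_mem_zmultiples hT hS
  exact weilPairingFun_nsmul_self hT n

/-- **Coordinates in a frame through `T`**: for `T ∈ E[N] ∖ {O}` there is `S₁ ∈ E[N]` such that
every `S ∈ E[N]` is `a • T + b • S₁` with `a, b < N` (a frame `E[N] ≃ 𝔽_N²` with `T ↦ (1,0)`,
tree `exists_addEquiv_apply_eq_single`). [folklore] -/
theorem exists_frame_partner {T : W.geomPoints} (hT : (N : ℤ) • T = 0) (hT0 : T ≠ 0) :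
    ∃ S₁ : W.geomPoints, (N : ℤ) • S₁ = 0 ∧
      ∀ S : W.geomPoints, (N : ℤ) • S = 0 → ∃ a b : ℕ, b < N ∧ S = a • T + b • S₁ := by
  have hTmem : T ∈ geomTorsion W N := by rw [mem_torsionBy_iff]; exact hT
  set Tt : geomTorsion W N := ⟨T, hTmem⟩ with hTt
  have hTt0 : Tt ≠ 0 := fun h => hT0 (congrArg Subtype.val h)
  obtain ⟨fr, hfr⟩ := exists_addEquiv_apply_eq_single W N hTt0
  letI : Module (ZMod N) (geomTorsion W N) := AddSubgroup.torsionBy.zmodModule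
  set S₁t : geomTorsion W N := fr.symm (Pi.single 1 1) with hS₁t
  refine ⟨(S₁t : W.geomPoints), ?_, fun S hS => ?_⟩
  · exact (mem_torsionBy_iff).mp S₁t.2
  · have hSmem : S ∈ geomTorsion W N := by rw [mem_torsionBy_iff]; exact hS
    set St : geomTorsion W N := ⟨S, hSmem⟩ with hSt
    set v := fr St with hv
    have hvdec : v = (v 0).val • (Pi.single 0 1 : Fin 2 → ZMod N) +
        (v 1).val • (Pi.single 1 1 : Fin 2 → ZMod N) := by
      ext i
      simp only [Pi.add_apply, Pi.smul_apply]
      fin_cases i <;> simp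
    have hStdec : St = (v 0).val • Tt + (v 1).val • S₁t := by
      apply fr.injective
      rw [map_add, map_nsmul, map_nsmul, hfr, hS₁t, AddEquiv.apply_symm_apply, ← hv]
      exact hvdec
    refine ⟨(v 0).val, (v 1).val, ZMod.val_lt _, ?_⟩
    have h1 := congrArg Subtype.val hStdec
    rw [AddSubgroup.coe_add, AddSubmonoidClass.coe_nsmul, AddSubmonoidClass.coe_nsmul] at h1
    exact h1

/-- **The pairing in a frame**: for `T ∈ E[N] ∖ {O}` (`N` prime) there is `S₁ ∈ E[N]` with
`ε₁ = e(S₁, T)` a **primitive** `N`-th root of unity such that every `S ∈ E[N]` is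
`a • T + b • S₁` with `b < N` and `e(S, T) = ε₁ᵇ` (bilinearity and `e(T,T) = 1`,
Prop. III.8.1(a),(b); `ε₁ ≠ 1` by non-degeneracy III.8.1(c), for otherwise `e(·, T) ≡ 1`).
[cite: SilvermanAEC2009, Prop. III.8.1(a)–(c)] -/
theorem weilPairingFun_frame {T : W.geomPoints} (hT : (N : ℤ) • T = 0) (hT0 : T ≠ 0) :
    ∃ S₁ : W.geomPoints, (N : ℤ) • S₁ = 0 ∧
      IsPrimitiveRoot (weilPairingFun (natCast_level_ne_zero F N) S₁ T) N ∧
      ∀ S : W.geomPoints, (N : ℤ) • S = 0 → ∃ a b : ℕ, b < N ∧ S = a • T + b • S₁ ∧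
        weilPairingFun (natCast_level_ne_zero F N) S T =
          weilPairingFun (natCast_level_ne_zero F N) S₁ T ^ b := by
  have hN : N.Prime := Fact.out
  set hNF := natCast_level_ne_zero F N
  obtain ⟨S₁, hS₁, hdec⟩ := exists_frame_partner hT hT0
  set ε₁ := weilPairingFun hNF S₁ T with hε₁
  have hεN : ε₁ ^ N = 1 := weilPairingFun_pow hNF hS₁ hT
  have hformula : ∀ S : W.geomPoints, (N : ℤ) • S = 0 → ∃ a b : ℕ, b < N ∧
      S = a • T + b • S₁ ∧ weilPairingFun hNF S T = ε₁ ^ b := by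
    intro S hS
    obtain ⟨a, b, hb, rfl⟩ := hdec S hS
    have haT : (N : ℤ) • (a • T) = 0 := by rw [smul_comm, hT, smul_zero]
    have hbS : (N : ℤ) • (b • S₁) = 0 := by rw [smul_comm, hS₁, smul_zero]
    refine ⟨a, b, hb, rfl, ?_⟩
    rw [weilPairingFun_add_left hNF haT hbS hT, weilPairingFun_nsmul_self hT a, one_mul,
      weilPairingFun_nsmul_left hNF hS₁ hT]
  have hε1 : ε₁ ≠ 1 := by
    intro h1
    apply hT0
    refine eq_zero_of_weilPairingFun_eq_one hNF hT fun S hS => ?_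
    obtain ⟨a, b, -, -, hf⟩ := hformula S hS
    rw [hf, h1, one_pow]
  have hprim : IsPrimitiveRoot ε₁ N := by
    have hd : orderOf ε₁ ∣ N := orderOf_dvd_of_pow_eq_one hεN
    rcases (Nat.dvd_prime hN).mp hd with h | h
    · exact absurd (orderOf_eq_one_iff.mp h) hε1
    · rw [← h]; exact IsPrimitiveRoot.orderOf ε₁
  exact ⟨S₁, hS₁, hprim, hformula⟩

/-- **The kernel of `e(·, T)` on `E[N]` is `⟨T⟩`** (`N` prime, `T ≠ O`): `e(S, T) = 1 ⟹ S ∈ ⟨T⟩`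
(in the frame, `ε₁ᵇ = 1` forces `N ∣ b`, `b = 0`). [cite: SilvermanAEC2009, Prop. III.8.1(a)–(c)] -/
theorem mem_zmultiples_of_weilPairingFun_eq_one {T : W.geomPoints} (hT : (N : ℤ) • T = 0)
    (hT0 : T ≠ 0) {S : W.geomPoints} (hS : (N : ℤ) • S = 0)
    (h1 : weilPairingFun (natCast_level_ne_zero F N) S T = 1) : S ∈ AddSubgroup.zmultiples T := by
  obtain ⟨S₁, -, hprim, hformula⟩ := weilPairingFun_frame hT hT0
  obtain ⟨a, b, hb, rfl, hf⟩ := hformula S hS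
  rw [hf] at h1
  have hb0 : b = 0 := Nat.eq_zero_of_dvd_of_lt ((hprim.pow_eq_one_iff_dvd b).mp h1) hb
  subst hb0
  rw [zero_nsmul, add_zero]
  exact (AddSubgroup.zmultiples T).nsmul_mem (AddSubgroup.mem_zmultiples T) a

/-- **`e(·, T)` maps `E[N]` onto `μ_N`** (`N` prime, `T ≠ O`): every `ζ` with `ζᴺ = 1` is
`e(S, T)` for some `S ∈ E[N]` (a power of the primitive root `ε₁ = e(S₁, T)`).
[cite: SilvermanAEC2009, Prop. III.8.1(a)–(c)] -/
theorem exists_weilPairingFun_eq {T : W.geomPoints} (hT : (N : ℤ) • T = 0) (hT0 : T ≠ 0)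
    {ζ : AlgebraicClosure F} (hζ : ζ ^ N = 1) :
    ∃ S : W.geomPoints, (N : ℤ) • S = 0 ∧ weilPairingFun (natCast_level_ne_zero F N) S T = ζ := by
  obtain ⟨S₁, hS₁, hprim, -⟩ := weilPairingFun_frame hT hT0
  obtain ⟨k, -, hk⟩ := hprim.eq_pow_of_pow_eq_one hζ
  refine ⟨k • S₁, by rw [smul_comm, hS₁, smul_zero], ?_⟩
  rw [weilPairingFun_nsmul_left _ hS₁ hT, hk]

end Pairing

/-! ### The descent lemma -/

section Descent

variable {N : ℕ} [Fact N.Prime] [NeZero (N : F)]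

/-- **Descent through a rational cyclic `N`-kernel, Kummer form (Silverman, *AEC*,
Exercise 10.1(c); `N` prime).** Let `T ∈ E(K̄)` be a `Γ_F`-fixed point of order `N`, and
`f ∈ K̄(E)` a function with `ord_Q f = N([Q = T] - [Q = O])` (a Kummer function `f_T`; only its
divisor and its two values below enter). Let `R₂` be a point whose coset `R₂ + ⟨T⟩` is `Γ_F`-stable, with `N R₂ = P₂ ∉ {O, T}`
(normalisation), and let `P ≠ O, T` be a `Γ_F`-fixed point with **`f(P) = uᴺ · f(P₂)`, `u ∈ F`**.
Then there is `R ∈ E(K̄)` with `N R = P` whose coset `R + ⟨T⟩` is `Γ_F`-stable: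
`σ R - R ∈ ⟨T⟩` for all `σ ∈ Γ_F`. (With `φ : E → E/⟨T⟩`: `φ R ∈ (E/⟨T⟩)(F)` and `φ̂ (φ R) = P`,
i.e. `P ∈ φ̂((E/⟨T⟩)(F))`: the class `f(P)` in `Fˣ/Fˣᴺ` of the `φ̂`-Kummer map detects
divisibility by `φ̂`.) Proof in the module docstring. [cite: SilvermanAEC2009, Exercise 10.1(c) (PDF p. 304) and III.§8, Prop. III.8.1] -/
theorem exists_stableCoset_of_kummer_eq_pow {T : W.geomPoints} (hT : (N : ℤ) • T = 0)
    (hT0 : T ≠ 0) (hTfix : ∀ σ : Field.absoluteGaloisGroup F, σ • T = T)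
    {f : W.geomFunctionField} (hf0 : f ≠ 0)
    (hford : ∀ Q : W.geomPoints, ord (W.baseChange (AlgebraicClosure F)).toAffine Q f =
      (N : ℤ) * ((if Q = T then 1 else 0) - (if Q = 0 then 1 else 0)))
    {R₂ : W.geomPoints}
    (hR₂ : ∀ σ : Field.absoluteGaloisGroup F, σ • R₂ - R₂ ∈ AddSubgroup.zmultiples T)
    (hR₂0 : (N : ℤ) • R₂ ≠ 0) (hR₂T : (N : ℤ) • R₂ ≠ T)
    {P : W.geomPoints} (hPfix : ∀ σ : Field.absoluteGaloisGroup F, σ • P = P) (hP0 : P ≠ 0)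
    (hPT : P ≠ T) {a b : AlgebraicClosure F} (ha : W.HasValueAt f P a)
    (hb : W.HasValueAt f ((N : ℤ) • R₂) b) {u : F}
    (hab : a = algebraMap F (AlgebraicClosure F) u ^ N * b) :
    ∃ R : W.geomPoints, (N : ℤ) • R = P ∧
      ∀ σ : Field.absoluteGaloisGroup F, σ • R - R ∈ AddSubgroup.zmultiples T := by
  have hNp : N.Prime := Fact.out
  set hNF := natCast_level_ne_zero F N
  have hNZ : (N : ℤ) ≠ 0 := by exact_mod_cast hNp.ne_zero
  have hNF' : ((N : ℤ) : F) ≠ 0 := by exact_mod_cast hNF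
  -- the Weil function of `T`
  set h := weilFn hNF hT with hh_def
  have hh : IsWeilFunction W N T h := isWeilFunction_weilFn hNF hT
  have hh0 : h ≠ 0 := hh.1
  -- `[N]^* f = c · h ^ N`
  set Fz := (Isogeny.zsmul W (N : ℤ) hNZ).pullbackHom f with hFz
  have hFz0 : Fz ≠ 0 := (map_ne_zero_iff _ (Isogeny.zsmul W (N : ℤ) hNZ).pullbackHom.injective).mpr hf0
  have hhN0 : h ^ N ≠ 0 := pow_ne_zero N hh0
  obtain ⟨c, hc0, hFc⟩ : ∃ c : AlgebraicClosure F, c ≠ 0 ∧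
      Fz = algebraMap (AlgebraicClosure F) W.geomFunctionField c * h ^ N := by
    refine exists_eq_smul_of_ord_eq hhN0 hFz0 fun Q => ?_
    obtain ⟨-, T', hT', hordh⟩ := hh
    rw [ord_pow _ hh0, hFz, ord_pullbackHom_zsmul hNZ hNF' Q f, hford, hordh]
    unfold torsionInd
    rw [smul_sub, hT', sub_eq_zero]
  -- an `N`-th root `R₁` of `P`
  obtain ⟨R₁, hR₁⟩ := zsmul_geomPoints_surjective_holds W hNZ P
  change (N : ℤ) • R₁ = P at hR₁
  have hR₁0 : (N : ℤ) • R₁ ≠ 0 := by rw [hR₁]; exact hP0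
  have hR₁T : (N : ℤ) • R₁ ≠ T := by rw [hR₁]; exact hPT
  -- values: `h(R₁) = w₁ ≠ 0`, `h(R₂) = w₂ ≠ 0`, `a = c w₁ᴺ`, `b = c w₂ᴺ`
  have hvalF : ∀ {R : W.geomPoints} (hR : (N : ℤ) • R ≠ 0) (hRT : (N : ℤ) • R ≠ T)
      {v : AlgebraicClosure F}, W.HasValueAt f ((N : ℤ) • R) v →
      ∃ w : AlgebraicClosure F, w ≠ 0 ∧ W.HasValueAt h R w ∧ v = c * w ^ N := by
    intro R hR hRT v hv
    obtain ⟨w, hw0, hw⟩ := hh.exists_value hR hRT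
    have hR0 : R ≠ 0 := by rintro rfl; exact hR (smul_zero _)
    have h1 : W.HasValueAt Fz R v := hasValueAt_pullbackHom_zsmul hNZ hR hv
    have h2 : W.HasValueAt Fz R (c * w ^ N) := by rw [hFc]; exact (hw.pow N).const_mul c
    exact ⟨w, hw0, hw, h1.unique hR0 h2⟩
  obtain ⟨w₁, hw₁0, hw₁, haw⟩ := hvalF hR₁0 hR₁T (hR₁ ▸ ha)
  obtain ⟨w₂, hw₂0, hw₂, hbw⟩ := hvalF hR₂0 hR₂T hb
  have hb0 : b ≠ 0 := by rw [hbw]; exact mul_ne_zero hc0 (pow_ne_zero N hw₂0)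
  set u' : AlgebraicClosure F := algebraMap F (AlgebraicClosure F) u with hu'
  have hu'0 : u' ≠ 0 := by
    intro h0
    rw [h0, zero_pow hNp.ne_zero, zero_mul] at hab
    rw [hab] at haw
    exact mul_ne_zero hc0 (pow_ne_zero N hw₁0) haw.symm
  -- `ζ = w₁ / (w₂ u')` is an `N`-th root of unity
  set ζ : AlgebraicClosure F := w₁ / (w₂ * u') with hζ
  have hw₁N : w₁ ^ N = (w₂ * u') ^ N := by
    have e1 : c * w₁ ^ N = u' ^ N * (c * w₂ ^ N) := by rw [← haw, ← hbw]; exact hab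
    apply mul_left_cancel₀ hc0
    rw [e1]; ring
  have hζN : ζ ^ N = 1 := by
    rw [hζ, div_pow, hw₁N, div_self (pow_ne_zero N (mul_ne_zero hw₂0 hu'0))]
  -- shift `R₁` by `S₀` with `e(S₀, T) = ζ⁻¹`
  obtain ⟨S₀, hS₀, heS₀⟩ := exists_weilPairingFun_eq (F := F) hT hT0 (ζ := ζ⁻¹)
    (by rw [inv_pow, hζN, inv_one])
  set R := R₁ + S₀ with hRdef
  have hNR : (N : ℤ) • R = P := by rw [hRdef, smul_add, hS₀, add_zero, hR₁]
  have hR0' : (N : ℤ) • R ≠ 0 := by rw [hNR]; exact hP0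
  have hRT' : (N : ℤ) • R ≠ T := by rw [hNR]; exact hPT
  obtain ⟨w, hw0, hw⟩ := hh.exists_value hR0' hRT'
  have hwζ : w = ζ⁻¹ * w₁ := by
    rw [← heS₀]; exact hh.hasValueAt_add hNF hT hS₀ hR₁0 hw₁ (by rw [← hRdef]; exact hw)
  have hwu : w = u' * w₂ := by
    rw [hwζ, hζ, inv_div, div_mul_cancel₀ _ hw₁0, mul_comm]
  refine ⟨R, hNR, fun σ => ?_⟩
  -- Galois: `σ̃ h = λ h`; compare `σ w` and `σ w₂`
  obtain ⟨lam, hlam0, hlam⟩ := hh.exists_galFunctionField_eq σ (hTfix σ)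
  have hσR : (N : ℤ) • (σ • R - R) = 0 := by rw [smul_sub, smul_comm, hNR, hPfix σ, sub_self]
  have hσR₂ : (N : ℤ) • (σ • R₂ - R₂) = 0 := by
    obtain ⟨n, hn⟩ := exists_nsmul_eq_of_mem_zmultiples hT (hR₂ σ)
    rw [← hn, smul_comm, hT, smul_zero]
  have e1 := hh.smul_value hNF hT σ (hTfix σ) hlam hR0' hRT' hσR hw
  have e2 := hh.smul_value hNF hT σ (hTfix σ) hlam hR₂0 hR₂T hσR₂ hw₂
  rw [weilPairingFun_eq_one_of_mem_zmultiples hT (hR₂ σ), mul_one] at e2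
  -- `σ w = σ(u' w₂) = u' σ(w₂) = u' λ w₂ = λ w`, so `e(σR - R, T) = 1`
  have hσu : galRingHom σ u' = u' := by
    rw [galRingHom_apply, hu']; exact smul_algebraMap σ u
  have key : weilPairingFun hNF (σ • R - R) T = 1 := by
    have h3 : galRingHom σ w = lam * w := by
      rw [hwu, map_mul, hσu, e2]; ring
    rw [h3] at e1
    have := mul_right_cancel₀ hw0 e1
    -- `lam = lam * e`
    exact (mul_eq_left₀ hlam0).mp this.symm
  exact mem_zmultiples_of_weilPairingFun_eq_one hT hT0 hσR key

end Descent

end WeierstrassCurve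

end
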